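import Summits.ResolutionOfSingularities.ResolutionOfSingularities.Theorems.MarkedTransferCampaignW21OrderBoundInClass
import Literature.RingTheory.MvPowerSeries.MaximalIdealPow
import Mathlib.RingTheory.MvPowerSeries.Order
import HarnessLib

/-!
# [OURS · L1 W2.1] The Case-(I) order bound on the class `MinDegreeTop` — PROVED for every prime `p`

Rung L (rescue) of cell res-hironaka, RESCUE-SEED row L-G2, slot W2.1 (hypothesis mining for the diff-product order
bound), kill test K2.1 (seat res-L1-k21; PREREG `L/res-L1-k21/PREREG-K2.1.md`). The OURS campaign file
`MarkedTransferCampaignW21OrderBoundInClass.lean` (typer res-L1-type-o3, p461953) states, per prime `p`, the order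
bound `OrderBoundOn p C` for the Case-(I) diff-product `H♭(ε) = u₀⁻¹ ∂^{(α+pβ)}ε · ∂^{(qγ₀)}ε` (row 057 carrier
`HFlat.caseI` evaluated at the tree's divided derivatives `hasseDeriv` on `K[[x₁,…,xₙ]]`) restricted to a class `C`
of standard-expression data, and names `OrderBoundMinDegreeTop p := OrderBoundOn p MinDegreeTop` — the bound on the
class «the lexicographic top term has total degree `ord ε`», i.e. the NAMED `P` of a «FOLLOWS-MODULO-P» reading of
GAP row R05 and the class `C_A` of kill test K2.1.

THIS FILE PROVES `OrderBoundMinDegreeTop p` for every prime `p` (`orderBoundMinDegreeTop_holds`), from three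
elementary order facts about divided derivatives of formal power series over any commutative ring (`ord f ≤
ord Δ_α f + |α|`; the product form; the sufficient condition `|α + β| ≤ ord f`), the bridge `adicOrder = order` on
`K[[x]]`, and `ord` of a unit `= 0`. No Lucas argument and no use of the standard expression beyond the class
equality is needed: on `MinDegreeTop` the printed chain «≥ ord ε − |α+pβ+qγ₀| + ord ε ≥ ord ε» (Rem. 9.9 (1) p.51
L5–L6 of the manuscript under adjudication [claim: Hironaka2017, status: under-review]) is literally valid, and that is
all this file formalises. Everything here is OURS / folklore; nothing is a statement of or about the manuscript, and
nothing here bears on the unrestricted claim (GAP row R05, under adjudication). AI-produced formalisation; expert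
review is stronger than AI review.
-/

noncomputable section

set_option linter.dupNamespace false -- mandated namespace of this single-conjunct summit

namespace Summit.ResolutionOfSingularities.ResolutionOfSingularities.Theorems

namespace CampaignW21

open Literature.AlgebraicGeometry.Hironaka2017.S09LLUED
open Literature.AlgebraicGeometry.Hironaka2017.S09LLUED.TopFrontier
open Literature.AlgebraicGeometry.Resolution
open Literature.RingTheory.MvPowerSeries

universe u v

section HasseOrder

variable {A : Type u} [CommRing A] {τ : Type v}

/-- A nonzero coefficient of `Δ_α f` at `β` forces a nonzero coefficient of `f` at `α + β` (coefficient formula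
`coeff β (Δ_α f) = C(α+β, α) · coeff (α+β) f`). [folklore] -/
theorem coeff_add_ne_zero_of_coeff_hasseDeriv_ne_zero {α β : τ →₀ ℕ} {f : MvPowerSeries τ A}
    (h : MvPowerSeries.coeff β (hasseDeriv α f) ≠ 0) : MvPowerSeries.coeff (α + β) f ≠ 0 := by
  intro h0
  apply h
  rw [coeff_hasseDeriv, h0, mul_zero]

/-- **Divided derivatives lower the order by at most `|α|`**: `ord f ≤ ord (Δ_α f) + |α|` in `ℕ∞`
(`|α| = Finsupp.degree α`), for `f ∈ A⟦X_s : s ∈ τ⟧`, `τ` finite, `A` any commutative ring. [folklore] -/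
theorem order_le_order_hasseDeriv_add_degree [Finite τ] (α : τ →₀ ℕ) (f : MvPowerSeries τ A) :
    f.order ≤ (hasseDeriv α f).order + ((Finsupp.degree α : ℕ) : ℕ∞) := by
  by_cases h : hasseDeriv α f = 0
  · rw [h, MvPowerSeries.order_zero, top_add]
    exact le_top
  · obtain ⟨d, hd, hdeg⟩ :=
      MvPowerSeries.exists_coeff_ne_zero_and_order (MvPowerSeries.ne_zero_iff_order_finite.mp h)
    have hle : f.order ≤ ((Finsupp.degree (α + d) : ℕ) : ℕ∞) :=
      MvPowerSeries.order_le (coeff_add_ne_zero_of_coeff_hasseDeriv_ne_zero hd)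
    rw [map_add, Nat.cast_add, hdeg, add_comm] at hle
    exact hle

/-- **Product of two divided derivatives of one series**: `2 · ord f ≤ ord (Δ_α f · Δ_β f) + |α + β|` — the
first inequality of the printed chain of Rem. 9.9 (1), valid unconditionally. [folklore] -/
theorem two_mul_order_le_order_hasseDeriv_mul_add [Finite τ] (α β : τ →₀ ℕ) (f : MvPowerSeries τ A) :
    2 * f.order ≤ (hasseDeriv α f * hasseDeriv β f).order + ((Finsupp.degree (α + β) : ℕ) : ℕ∞) := by
  have hα := order_le_order_hasseDeriv_add_degree α f
  have hβ := order_le_order_hasseDeriv_add_degree β f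
  have hmul : (hasseDeriv α f).order + (hasseDeriv β f).order ≤ (hasseDeriv α f * hasseDeriv β f).order :=
    MvPowerSeries.le_order_mul
  rw [map_add, Nat.cast_add, two_mul]
  calc f.order + f.order
      ≤ ((hasseDeriv α f).order + ((Finsupp.degree α : ℕ) : ℕ∞)) +
          ((hasseDeriv β f).order + ((Finsupp.degree β : ℕ) : ℕ∞)) := add_le_add hα hβ
    _ = ((hasseDeriv α f).order + (hasseDeriv β f).order) +
          (((Finsupp.degree α : ℕ) : ℕ∞) + ((Finsupp.degree β : ℕ) : ℕ∞)) := by rw [add_add_add_comm]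
    _ ≤ (hasseDeriv α f * hasseDeriv β f).order +
          (((Finsupp.degree α : ℕ) : ℕ∞) + ((Finsupp.degree β : ℕ) : ℕ∞)) := add_le_add_left hmul _

/-- **Sufficient condition for `ord f ≤ ord (Δ_α f · Δ_β f)`**: `|α + β| ≤ ord f` (the second inequality of the
printed chain of Rem. 9.9 (1) under its unprinted hypothesis). [folklore] -/
theorem order_le_order_hasseDeriv_mul_of_degree_le [Finite τ] (α β : τ →₀ ℕ) (f : MvPowerSeries τ A)
    (h : ((Finsupp.degree (α + β) : ℕ) : ℕ∞) ≤ f.order) :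
    f.order ≤ (hasseDeriv α f * hasseDeriv β f).order := by
  have h2 := two_mul_order_le_order_hasseDeriv_mul_add α β f
  by_cases hf : f = 0
  · subst hf
    rw [map_zero, zero_mul, MvPowerSeries.order_zero]
  · have hfin : f.order = (f.order.toNat : ℕ∞) := (MvPowerSeries.ne_zero_iff_order_finite.mp hf).symm
    set N : ℕ := Finsupp.degree (α + β) with hN
    set P := (hasseDeriv α f * hasseDeriv β f).order with hP
    rw [hfin] at h h2 ⊢
    have hNle : N ≤ f.order.toNat := by exact_mod_cast h
    by_cases hP' : P = ⊤
    · rw [hP']; exact le_top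
    · have hPfin : P = (P.toNat : ℕ∞) := (ENat.coe_toNat hP').symm
      rw [hPfin] at h2 ⊢
      have h2' : 2 * f.order.toNat ≤ P.toNat + N := by exact_mod_cast h2
      exact_mod_cast (by omega : f.order.toNat ≤ P.toNat)

end HasseOrder

section Bridge

variable {K : Type} [Field K] {σ : Type} [Finite σ]

/-- **Bridge**: on `K[[x]] = MvPowerSeries σ K` (`K` a field, `σ` finite) the `𝔪`-adic order of the tree
(`Resolution.adicOrder`, «`n ≤ ord f ⟺ f ∈ 𝔪ⁿ`») is Mathlib's `MvPowerSeries.order` (least total degree of a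
nonzero coefficient), via `Jets.le_order_iff_mem_maximalIdeal_pow`. [folklore] -/
theorem adicOrder_eq_order (f : MvPowerSeries σ K) : adicOrder f = f.order := by
  apply le_antisymm
  · refine ENat.forall_natCast_le_iff_le.mp fun k hk => ?_
    exact Jets.le_order_iff_mem_maximalIdeal_pow.mpr ((le_adicOrder_iff f k).mp hk)
  · refine ENat.forall_natCast_le_iff_le.mp fun k hk => ?_
    exact (le_adicOrder_iff f k).mpr (Jets.le_order_iff_mem_maximalIdeal_pow.mp hk)

end Bridge

/-- **[OURS · L1 W2.1] `OrderBoundMinDegreeTop p` HOLDS for every prime `p`.** On the class `MinDegreeTop`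
(«the lexicographic top term `u₀x^αx^{pβ}x^{qγ₀}` of the standard expression has total degree `ord ε`») the
Case-(I) diff-product `H♭(ε) = u₀⁻¹ ∂^{(α+pβ)}ε · ∂^{(qγ₀)}ε` (row 057 `HFlat.caseI` at `∂ = hasseDeriv`) satisfies
`ord ε ≤ ord H♭(ε)` in `K[[x₁,…,xₙ]]`, for every field `K` of characteristic `p`, every `n, e, ℓ`, every standard
expression. Proof: `ord(u₀⁻¹·A·B) ≥ ord A + ord B` (`adicOrder_add_adicOrder_le_mul`, `adicOrder_of_isUnit`),
`adicOrder = order` on `K[[x]]`, and `order_le_order_hasseDeriv_mul_of_degree_le` with `|α+pβ| + |qγ₀| =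
|α+pβ+qγ₀| = ord ε`. Neither the Case-(I) hypothesis nor the `Standing` hypotheses nor `CharP` are used (they are
binders of `OrderBoundOn`). Replaces the role of Rem. 9.9 (1) / Def. 9.12's order clause ON THIS CLASS ONLY; NOT a
statement of the manuscript; says nothing about GAP row R05 (the unrestricted claim). [folklore] -/
theorem orderBoundMinDegreeTop_holds (p : ℕ) [Fact p.Prime] : OrderBoundMinDegreeTop p := by
  intro K _ _ n e ℓ ε S h0 hS _hI hC
  have hdeg := hC h0
  -- abbreviations
  set α' : Fin n →₀ ℕ := alpha S.support S.u + p • beta S.support S.u with hα'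
  set γ' : Fin n →₀ ℕ := p ^ e • gamma S.support S.u ⟨0, h0⟩ with hγ'
  set u := hS.unit_u0.unit with hu
  -- unfold the Case-(I) formula: `↑u⁻¹ * ∂^{α'} ε * ∂^{γ'} ε`
  show adicOrder ε ≤ adicOrder ((↑u⁻¹ : MvPowerSeries (Fin n) K) * hasseD K n α' ε * hasseD K n γ' ε)
  have hunit : adicOrder ((↑u⁻¹ : MvPowerSeries (Fin n) K)) = 0 := adicOrder_of_isUnit (Units.isUnit _)
  have hprod : adicOrder (hasseD K n α' ε * hasseD K n γ' ε) ≤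
      adicOrder ((↑u⁻¹ : MvPowerSeries (Fin n) K) * hasseD K n α' ε * hasseD K n γ' ε) := by
    have := adicOrder_add_adicOrder_le_mul (↑u⁻¹ : MvPowerSeries (Fin n) K) (hasseD K n α' ε * hasseD K n γ' ε)
    rw [hunit, zero_add, ← mul_assoc] at this
    exact this
  refine le_trans ?_ hprod
  -- now a statement about `MvPowerSeries.order`
  rw [adicOrder_eq_order, adicOrder_eq_order]
  show ε.order ≤ (hasseDeriv α' ε * hasseDeriv γ' ε).order
  apply order_le_order_hasseDeriv_mul_of_degree_le
  -- `|α' + γ'| ≤ ord ε` from the class equality `ord ε = |α + pβ + qγ₀|`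
  rw [adicOrder_eq_order] at hdeg
  rw [hdeg]

end CampaignW21

end Summit.ResolutionOfSingularities.ResolutionOfSingularities.Theorems

end
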